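import Mathlib
import HarnessLib

/-!
# Crux `TropicalWeilVanishing` (stmt-HodgeConjecture-18478) — the MOMENT IDENTITY of a balanced weighted graph,
# concurrency from zero moment, and the positive-cone lemma behind the junction system (I)/(II)

Route `TropicalWeilObstruction` of `HodgeConjecture`; cell `pub-hodge-tropical` (Hodge NEGATION SINK — scoped exploration,
cap 2 seats, no summit claim), seat tropical-2 gen 13 (`prover-pub-hodge-tropical-2-g13-0`, 2026-08-23), written while
REFEREEING tropical-1 gen 13/14's `certificates/splitrigidity/` (Theorem R §4(c), junction system §11). HONEST FRAMING: four
elementary algebraic identities, stated over an arbitrary module so that "valid in any ambient dimension" is a kernel fact; they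
are the algebra inside ONE step of a paper proof about configurations at the NON-generic split period; they decide nothing about
K1 (`TropicalWeilVanishing`, OPEN) or K1_∂ (OPEN) and nothing here bears on the Hodge conjecture. negation-sink work.

The objects. A finite weighted graph drawn with straight edges in a `K`-module `V`: vertices `pos : ι → V`; bounded edges
`e : E` from `src e` to `tgt e` with direction `dir e`, weight `wE e` and `pos (tgt e) - pos (src e) = len e • dir e`; unbounded
ENDS `r : R` attached at the vertex `base r` with direction `nR r` and weight `wR r`. BALANCING at a vertex `v`: the weighted
outgoing directions sum to zero, `Σ_{src e = v} wE e • dir e − Σ_{tgt e = v} wE e • dir e + Σ_{base r = v} wR r • nR r = 0`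
(a finite tropical curve, its recession rays being the ends; no planarity, rationality or positivity is assumed).
* `ends_sum_eq_zero` — RECESSION BALANCING: `Σ_r wR r • nR r = 0` (sum of all vertex balancings; bounded edges cancel).
* `moment_identity` — for every alternating bilinear `β : V → V → P`: `Σ_r wR r • β (pos (base r)) (nR r) = 0` — the identity
  `Σ_ends W (a ∧ n) = 0` of `certificates/splitrigidity` §4(c) and the source of equation (II) of the junction system (§11), in ANY
  module (`Σ_v β(pos v, balance v) = 0`, and a bounded edge contributes `wE • β(pos src − pos tgt, dir) = −wE·len • β(dir, dir) = 0`);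
  `moment_identity_translate` — hence the total moment of the ends is the same about every origin; `sum_moment_by_class`,
  `averaged_moment_eq_zero` — sorting the ends into direction classes (the SHEETS of one half-plane), the moment of the weight-averaged
  lines equals the total moment, hence vanishes: averaging commutes with the moment (the step that makes §4(c) work sheet-free).
* `third_line_moment_eq_zero`, `exists_eq_add_smul_of_det_eq_zero` — CONCURRENCY (last step of §4(c)): if three weighted lines
  `aᵢ + K nᵢ` have `w₁n₁ + w₂n₂ + w₃n₃ = 0`, lines 1 and 2 pass through `q`, and the total moment `Σ wᵢ β(aᵢ, nᵢ)` vanishes, then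
  `w₃ β(a₃ − q, n₃) = 0`; in the plane `Fin 2 → K` with `β = det` this puts `q` on line 3.
* `apply_eq_zero_of_nonpos_of_sum_smul_eq_zero` — the one-dimensional HALF-SPACE LEMMA (§2 for k = 1 / the recession fan at a
  facet): positive weights, `Σ wᵢ • rᵢ = 0` and `φ(rᵢ) ≤ 0` for all `i` force `φ(rᵢ) = 0` for all `i`.
* `orth_of_orth_nonneg` — the POSITIVE-CONE LEMMA used to derive equation (I) of §11: if a linear map `f` kills a vector `W` with
  all coordinates positive, then a covector orthogonal to every NON-NEGATIVE element of `ker f` is orthogonal to all of `ker f`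
  (`μ + t W ≥ 0` for `t` large) — "the valid averaged combinations are exactly the `α ⊥ ker`, because the total weights are a strictly
  positive balanced vector".
Mathlib only; nothing is defined; no named fact; no sorry.

## References

* [Zharkov2020TropicalWeil] I. Zharkov, Tropical abelian varieties, Weil classes and the Hodge conjecture, arXiv:2002.02347
  (2020), p. 2 (balanced weighted polyhedral complexes = tropical cycles).
* [MikhalkinZharkov2014Eigenwave] G. Mikhalkin, I. Zharkov, Tropical eigenwave and intermediate Jacobians, LN UMI 15 (2014),
  Def. 4.2, Prop. 4.3 (balancing condition).
-/

set_option linter.dupNamespace false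

open scoped BigOperators

namespace Summit.HodgeConjecture.HodgeConjecture.Theorems.TropicalWeilVanishing.SplitRigidity

section Graph

variable {K : Type*} [Field K] {V : Type*} [AddCommGroup V] [Module K V] {P : Type*} [AddCommGroup P] [Module K P]
variable {ι E R : Type*} [Fintype ι] [Fintype E] [Fintype R] [DecidableEq ι]

/-- Swapping a fibrewise indicator sum: `Σ_v Σ_x [f x = v] g v x = Σ_x g (f x) x`. [folklore] -/
theorem sum_sum_ite_eq_apply {M : Type*} [AddCommMonoid M] {X : Type*} [Fintype X] (f : X → ι) (g : ι → X → M) :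
    (∑ v, ∑ x, if f x = v then g v x else 0) = ∑ x, g (f x) x := by
  rw [Finset.sum_comm]
  refine Finset.sum_congr rfl fun x _ => ?_
  rw [Finset.sum_ite_eq]
  simp

omit [Fintype ι] in
/-- Pushing an additive map through an indicator sum: `γ (Σ_x [c x = v] f x) = Σ_x [c x = v] γ (f x)`. [folklore] -/
theorem apply_sum_ite {M N : Type*} [AddCommMonoid M] [AddCommMonoid N] {X : Type*} [Fintype X] {F : Type*}
    [FunLike F M N] [AddMonoidHomClass F M N] (γ : F) (c : X → ι) (v : ι) (f : X → M) :
    γ (∑ x, if c x = v then f x else 0) = ∑ x, if c x = v then γ (f x) else 0 := by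
  rw [map_sum]
  refine Finset.sum_congr rfl fun x _ => ?_
  split_ifs <;> simp

/-- **Recession balancing.** For a finite weighted graph with straight bounded edges and unbounded ends, balanced at every vertex,
the weighted directions of the ENDS sum to zero: `Σ_r wR r • nR r = 0` (add up all vertex balancings; each bounded edge enters
twice with opposite signs). [cite: MikhalkinZharkov2014Eigenwave, Def. 4.2] -/
theorem ends_sum_eq_zero (src tgt : E → ι) (dir : E → V) (wE : E → K) (base : R → ι) (nR : R → V) (wR : R → K)
    (hbal : ∀ v : ι, (∑ e, if src e = v then wE e • dir e else 0) - (∑ e, if tgt e = v then wE e • dir e else 0)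
      + (∑ r, if base r = v then wR r • nR r else 0) = 0) :
    ∑ r, wR r • nR r = 0 := by
  have htot : ∑ v, ((∑ e, if src e = v then wE e • dir e else 0) - (∑ e, if tgt e = v then wE e • dir e else 0)
      + (∑ r, if base r = v then wR r • nR r else 0)) = 0 := Finset.sum_eq_zero fun v _ => hbal v
  rw [Finset.sum_add_distrib, Finset.sum_sub_distrib,
    sum_sum_ite_eq_apply src (fun _ e => wE e • dir e), sum_sum_ite_eq_apply tgt (fun _ e => wE e • dir e),
    sum_sum_ite_eq_apply base (fun _ r => wR r • nR r), sub_self, zero_add] at htot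
  exact htot

/-- **Moment identity** (`certificates/splitrigidity` §4(c), junction equation (II) of §11), in any module: for a finite weighted
graph with straight edges (`pos (tgt e) - pos (src e) = len e • dir e`), balanced at every vertex, and ANY alternating bilinear
`β`, the total moment of the ends vanishes: `Σ_r wR r • β (pos (base r)) (nR r) = 0`. Proof: `Σ_v β (pos v) (balance v) = 0`;
the two occurrences of a bounded edge give `wE e • β (pos (src e) - pos (tgt e)) (dir e) = -(wE e * len e) • β (dir e) (dir e)
= 0`. No planarity is needed. [cite: MikhalkinZharkov2014Eigenwave, Def. 4.2] -/
theorem moment_identity (β : V →ₗ[K] V →ₗ[K] P) (hβ : ∀ x, β x x = 0)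
    (pos : ι → V) (src tgt : E → ι) (dir : E → V) (len wE : E → K) (base : R → ι) (nR : R → V) (wR : R → K)
    (hedge : ∀ e, pos (tgt e) - pos (src e) = len e • dir e)
    (hbal : ∀ v : ι, (∑ e, if src e = v then wE e • dir e else 0) - (∑ e, if tgt e = v then wE e • dir e else 0)
      + (∑ r, if base r = v then wR r • nR r else 0) = 0) :
    ∑ r, wR r • β (pos (base r)) (nR r) = 0 := by
  have htot : ∑ v, β (pos v) ((∑ e, if src e = v then wE e • dir e else 0)
      - (∑ e, if tgt e = v then wE e • dir e else 0) + (∑ r, if base r = v then wR r • nR r else 0)) = 0 :=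
    Finset.sum_eq_zero fun v _ => by rw [hbal v, map_zero]
  simp only [map_add, map_sub, apply_sum_ite] at htot
  rw [Finset.sum_add_distrib, Finset.sum_sub_distrib,
    sum_sum_ite_eq_apply src (fun v e => β (pos v) (wE e • dir e)),
    sum_sum_ite_eq_apply tgt (fun v e => β (pos v) (wE e • dir e)),
    sum_sum_ite_eq_apply base (fun v r => β (pos v) (wR r • nR r))] at htot
  -- the bounded edges cancel
  have hcancel : (∑ e, β (pos (src e)) (wE e • dir e)) - ∑ e, β (pos (tgt e)) (wE e • dir e) = 0 := by
    rw [← Finset.sum_sub_distrib]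
    refine Finset.sum_eq_zero fun e _ => ?_
    have h1 : pos (src e) = pos (tgt e) - len e • dir e := by rw [← hedge e]; abel
    rw [h1, map_sub, LinearMap.sub_apply]
    simp [hβ]
  rw [hcancel, zero_add] at htot
  simpa [map_smul] using htot

/-- Origin independence of the total moment of the ends (from recession balancing): translating every base point by `t` does not
change `Σ_r wR r • β (pos (base r)) (nR r)`. [folklore] -/
theorem moment_identity_translate (β : V →ₗ[K] V →ₗ[K] P) (src tgt : E → ι) (dir : E → V) (wE : E → K)
    (base : R → ι) (nR : R → V) (wR : R → K) (pos : ι → V) (t : V)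
    (hbal : ∀ v : ι, (∑ e, if src e = v then wE e • dir e else 0) - (∑ e, if tgt e = v then wE e • dir e else 0)
      + (∑ r, if base r = v then wR r • nR r else 0) = 0) :
    ∑ r, wR r • β (pos (base r) + t) (nR r) = ∑ r, wR r • β (pos (base r)) (nR r) := by
  have hends := ends_sum_eq_zero src tgt dir wE base nR wR hbal
  have : ∑ r, wR r • β t (nR r) = 0 := by
    have := congrArg (β t) hends
    simpa [map_sum, map_smul] using this
  simp only [map_add, LinearMap.add_apply, smul_add, Finset.sum_add_distrib, this, add_zero]

omit [Fintype ι] [DecidableEq ι] in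
/-- **Sheet averaging commutes with the moment** (the AVERAGING step of `certificates/splitrigidity` §4(c)): if the ends are
sorted into direction classes `cls : R → C` with `nR r = n (cls r)`, then the total moment of the ends equals the sum over the
classes of `β (Σ_{cls r = c} wR r • pos (base r)) (n c)` — the moment of the class's weight-AVERAGED line `w_c • ā_c`. [folklore] -/
theorem sum_moment_by_class (β : V →ₗ[K] V →ₗ[K] P) {C : Type*} [Fintype C] [DecidableEq C] (cls : R → C) (n : C → V)
    (pos : ι → V) (base : R → ι) (nR : R → V) (wR : R → K) (hcls : ∀ r, nR r = n (cls r)) :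
    ∑ c, β (∑ r, if cls r = c then wR r • pos (base r) else 0) (n c) = ∑ r, wR r • β (pos (base r)) (nR r) := by
  have : ∀ c, β (∑ r, if cls r = c then wR r • pos (base r) else 0) (n c)
      = ∑ r, if cls r = c then wR r • β (pos (base r)) (n c) else 0 := by
    intro c
    rw [map_sum, LinearMap.coe_sum, Finset.sum_apply]
    refine Finset.sum_congr rfl fun r _ => ?_
    split_ifs <;> simp
  simp only [this]
  rw [sum_sum_ite_eq_apply cls (fun c r => wR r • β (pos (base r)) (n c))]
  exact Finset.sum_congr rfl fun r _ => by rw [hcls r]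

/-- **The averaged moments vanish** (§4(c) assembled): for a balanced finite weighted graph with straight edges whose ends fall into
direction classes, `Σ_c β (w_c • ā_c) (n_c) = 0`, where `w_c • ā_c = Σ_{cls r = c} wR r • pos (base r)` is the weighted sum of the
base points of the ends of class `c`. With three classes, balanced class weights and two averaged lines through a point `q`,
`third_line_moment_eq_zero` then puts `q` on the third averaged line: the sheet-AVERAGED planes at a trivalent facet are concurrent.
[cite: MikhalkinZharkov2014Eigenwave, Def. 4.2] -/
theorem averaged_moment_eq_zero (β : V →ₗ[K] V →ₗ[K] P) (hβ : ∀ x, β x x = 0) {C : Type*} [Fintype C] [DecidableEq C]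
    (cls : R → C) (n : C → V)
    (pos : ι → V) (src tgt : E → ι) (dir : E → V) (len wE : E → K) (base : R → ι) (nR : R → V) (wR : R → K)
    (hcls : ∀ r, nR r = n (cls r)) (hedge : ∀ e, pos (tgt e) - pos (src e) = len e • dir e)
    (hbal : ∀ v : ι, (∑ e, if src e = v then wE e • dir e else 0) - (∑ e, if tgt e = v then wE e • dir e else 0)
      + (∑ r, if base r = v then wR r • nR r else 0) = 0) :
    ∑ c, β (∑ r, if cls r = c then wR r • pos (base r) else 0) (n c) = 0 := by
  rw [sum_moment_by_class β cls n pos base nR wR hcls]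
  exact moment_identity β hβ pos src tgt dir len wE base nR wR hedge hbal

end Graph

section Concurrency

variable {K : Type*} [Field K] {V : Type*} [AddCommGroup V] [Module K V] {P : Type*} [AddCommGroup P] [Module K P]

/-- **Zero moment ⇒ concurrency** (last step of `certificates/splitrigidity` §4(c)): three weighted lines `aᵢ + K·nᵢ` with
balanced weighted directions `w₁n₁ + w₂n₂ + w₃n₃ = 0`, the first two passing through `q`, and vanishing total moment
`Σ wᵢ β(aᵢ, nᵢ) = 0` for an alternating bilinear `β`: then `w₃ β(a₃ − q, n₃) = 0` (the third line has zero moment about `q`).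
[folklore] -/
theorem third_line_moment_eq_zero (β : V →ₗ[K] V →ₗ[K] P) (hβ : ∀ x, β x x = 0)
    (a₁ a₂ a₃ n₁ n₂ n₃ q : V) (w₁ w₂ w₃ t₁ t₂ : K)
    (h1 : a₁ = q + t₁ • n₁) (h2 : a₂ = q + t₂ • n₂) (hbal : w₁ • n₁ + w₂ • n₂ + w₃ • n₃ = 0)
    (hmom : w₁ • β a₁ n₁ + w₂ • β a₂ n₂ + w₃ • β a₃ n₃ = 0) :
    w₃ • β (a₃ - q) n₃ = 0 := by
  have hq : β q (w₁ • n₁ + w₂ • n₂ + w₃ • n₃) = 0 := by rw [hbal, map_zero]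
  rw [map_add, map_add, map_smul, map_smul, map_smul] at hq
  subst h1 h2
  simp only [map_add, LinearMap.add_apply, map_smul, LinearMap.smul_apply, hβ, smul_zero, add_zero] at hmom
  rw [map_sub, LinearMap.sub_apply, smul_sub]
  -- hmom : w₁ • β q n₁ + w₂ • β q n₂ + w₃ • β a₃ n₃ = 0 ; hq : w₁ • β q n₁ + w₂ • β q n₂ + w₃ • β q n₃ = 0
  have := sub_eq_zero.mpr (hmom.trans hq.symm)
  -- (… + w₃ β a₃ n₃) - (… + w₃ β q n₃) = w₃ β a₃ n₃ - w₃ β q n₃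
  have h' : w₁ • β q n₁ + w₂ • β q n₂ + w₃ • β a₃ n₃ - (w₁ • β q n₁ + w₂ • β q n₂ + w₃ • β q n₃)
      = w₃ • β a₃ n₃ - w₃ • β q n₃ := by abel
  rw [h'] at this
  exact this

/-- In the coordinate plane `Fin 2 → K`: if `det(u, n) = u 0 * n 1 - u 1 * n 0 = 0` and `n ≠ 0` then `u` is a multiple of `n`.
With `third_line_moment_eq_zero` (`β = det`, `w₃ ≠ 0`, `u = a₃ − q`): the point `q` lies on the third line `a₃ + K·n₃` — the three
sheet-averaged lines at a trivalent facet are CONCURRENT. [folklore] -/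
theorem exists_eq_smul_of_det_eq_zero (u n : Fin 2 → K) (hn : n ≠ 0) (hdet : u 0 * n 1 - u 1 * n 0 = 0) :
    ∃ t : K, u = t • n := by
  by_cases h0 : n 0 = 0
  · have h1 : n 1 ≠ 0 := by
      intro h1; apply hn; ext i; fin_cases i <;> simp [h0, h1]
    refine ⟨u 1 / n 1, ?_⟩
    have hu0 : u 0 = 0 := by
      have : u 0 * n 1 = 0 := by rw [h0, mul_zero, sub_zero] at hdet; exact hdet
      rcases mul_eq_zero.mp this with h | h
      · exact h
      · exact absurd h h1
    ext i; fin_cases i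
    · simp [hu0, h0]
    · simp [div_mul_cancel₀ _ h1]
  · refine ⟨u 0 / n 0, ?_⟩
    ext i; fin_cases i
    · simp [div_mul_cancel₀ _ h0]
    · have : u 1 * n 0 = u 0 * n 1 := by linear_combination -hdet
      simp only [Fin.mk_one, Pi.smul_apply, smul_eq_mul]
      field_simp
      linear_combination this

end Concurrency

section Positivity

variable {K : Type*} [Field K] [LinearOrder K] [IsStrictOrderedRing K] {V : Type*} [AddCommGroup V] [Module K V]
variable {H : Type*} [Fintype H]

/-- **Half-space lemma in dimension one** (`certificates/splitrigidity` §2 for `k = 1`; the recession fan of a facet): if positive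
weights `w` balance the directions `r`, `Σ wᵢ • rᵢ = 0`, and a linear functional is `≤ 0` on every `rᵢ`, then it vanishes on
every `rᵢ`. [folklore] -/
theorem apply_eq_zero_of_nonpos_of_sum_smul_eq_zero (φ : V →ₗ[K] K) (w : H → K) (r : H → V)
    (hw : ∀ i, 0 < w i) (hsum : ∑ i, w i • r i = 0) (hle : ∀ i, φ (r i) ≤ 0) (i : H) : φ (r i) = 0 := by
  have h0 : ∑ j, w j * φ (r j) = 0 := by
    have := congrArg φ hsum
    simpa [map_sum, map_smul] using this
  have hterm : ∀ j ∈ (Finset.univ : Finset H), w j * φ (r j) ≤ 0 :=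
    fun j _ => mul_nonpos_of_nonneg_of_nonpos (hw j).le (hle j)
  have hi := (Finset.sum_eq_zero_iff_of_nonpos hterm).mp h0 i (Finset.mem_univ i)
  rcases mul_eq_zero.mp hi with h | h
  · exact absurd h (hw i).ne'
  · exact h

/-- **Positive-cone lemma** (derivation of junction equation (I), `certificates/splitrigidity` §11): let `f : (H → K) → V` be
linear (e.g. `μ ↦ Σ_h μ_h n_h`) and suppose `ker f` contains a vector `W` with all coordinates positive (the total weights of the
half-planes at a face: strictly positive and balanced). If a covector `α` is orthogonal to every NON-NEGATIVE element of `ker f`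
(the weight vectors of the connected components of the local limit cycle), then `α` is orthogonal to ALL of `ker f`; so the
guaranteed valid combinations are exactly `(ker f)^⊥`, the `α_h = ν(n_h)`. [folklore] -/
theorem orth_of_orth_nonneg (f : (H → K) →ₗ[K] V) (W : H → K) (hW : ∀ h, 0 < W h) (hfW : f W = 0) (α : H → K)
    (horth : ∀ μ : H → K, (∀ h, 0 ≤ μ h) → f μ = 0 → ∑ h, α h * μ h = 0)
    (μ : H → K) (hμ : f μ = 0) : ∑ h, α h * μ h = 0 := by
  classical
  -- choose t with μ + t W ≥ 0 coordinatewise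
  obtain ⟨t, ht⟩ : ∃ t : K, ∀ h, 0 ≤ μ h + t * W h := by
    by_cases hne : (Finset.univ : Finset H).Nonempty
    · let m : K := Finset.univ.sup' hne fun h => -μ h / W h
      refine ⟨m, fun h => ?_⟩
      have hm : -μ h / W h ≤ m := Finset.le_sup' (fun h => -μ h / W h) (Finset.mem_univ h)
      have : -μ h ≤ m * W h := by
        have := mul_le_mul_of_nonneg_right hm (hW h).le
        rwa [div_mul_cancel₀ _ (hW h).ne'] at this
      linarith
    · refine ⟨0, fun h => ?_⟩
      exact absurd ⟨h, Finset.mem_univ h⟩ hne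
  have hαW : ∑ h, α h * W h = 0 := horth W (fun h => (hW h).le) hfW
  have hker : f (μ + t • W) = 0 := by rw [map_add, map_smul, hμ, hfW, smul_zero, add_zero]
  have hsum := horth (μ + t • W) (fun h => by simpa using ht h) hker
  have hsplit : ∑ h, α h * (μ + t • W) h = ∑ h, α h * μ h + t * ∑ h, α h * W h := by
    simp only [Pi.add_apply, Pi.smul_apply, smul_eq_mul, mul_add, Finset.sum_add_distrib, Finset.mul_sum]
    congr 1
    exact Finset.sum_congr rfl fun h _ => by ring
  rw [hsplit, hαW, mul_zero, add_zero] at hsum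
  exact hsum

end Positivity

end Summit.HodgeConjecture.HodgeConjecture.Theorems.TropicalWeilVanishing.SplitRigidity
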